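import Mathlib
import Literature.Probability.LatticeModels.LatticeAnimals
import Literature.Probability.LatticeModels.TriangularLatticeProofs

/-!
# Hexagonal lattice animals through a vertex

Route `SAWMassiveIsingTilt` of `CriticalPhenomena/SAWScalingLimit`; line `registered` of the crux
`CriticalCurveContinuity` (stmt-CriticalPhenomena-7686), cycle 3, sub-goal S-B. The one-site
Kotecký–Preiss smallness condition for the loop-`O(1)` gas on subgraphs of the honeycomb lattice
needs the standard entropy bound: the number of `hexGraph`-connected vertex sets of cardinality
`≤ n + 1` through a given face is at most `4 ^ (2 n)`. This is the instance `R := hexGraph.Adj`,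
`Δ := 3` (every face of the honeycomb lattice has exactly three neighbours,
`card_neighborSet_hexGraph_holds`) of the generic lazy-walk count
`Literature.Probability.LatticeModels.card_connectedFamily_le` (`≤ (Δ + 1) ^ (2 n)`).
-/

noncomputable section

open Literature.Probability Literature.Probability.LatticeModels

namespace Summit.CriticalPhenomena.SAWScalingLimit.Theorems.SAWMassiveIsingTilt

/-- S-B: **hexagonal lattice animals through a vertex.** A finite family of vertex sets of the
honeycomb lattice, each containing the face `v`, of cardinality at most `n + 1`, and
`hexGraph`-connected inside itself from `v`, has at most `4 ^ (2 n)` members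
(`card_connectedFamily_le` with `Δ = 3`, the neighbour family being the three neighbours of a face,
`card_neighborSet_hexGraph_holds`). -/
theorem card_hexConnected_family_le :
    ∀ (v : HexVertex) (n : ℕ) (𝒮 : Finset (Finset HexVertex)),
      (∀ A ∈ 𝒮, v ∈ A ∧ A.card ≤ n + 1 ∧
        ∀ w ∈ A, Relation.ReflTransGen (fun x y => hexGraph.Adj x y ∧ x ∈ A ∧ y ∈ A) v w) →
      𝒮.card ≤ 4 ^ (2 * n) := by
  intro v n 𝒮 h𝒮
  -- every face has exactly three neighbours: take `nbr x` to be this finite neighbourhood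
  have hfin : ∀ x : HexVertex, (hexGraph.neighborSet x).Finite := fun x =>
    Set.finite_of_ncard_ne_zero (by rw [card_neighborSet_hexGraph_holds x]; norm_num)
  have hΔ : ∀ x : HexVertex, (hfin x).toFinset.card ≤ 3 := fun x => by
    rw [← Set.ncard_eq_toFinset_card _ (hfin x), card_neighborSet_hexGraph_holds x]
  have hnbr : ∀ x y : HexVertex, hexGraph.Adj x y → y ∈ (hfin x).toFinset :=
    fun x y hxy => (Set.Finite.mem_toFinset _).2 ((SimpleGraph.mem_neighborSet _ _ _).2 hxy)
  calc 𝒮.card ≤ (3 + 1) ^ (2 * n) :=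
        card_connectedFamily_le (R := hexGraph.Adj) (nbr := fun x => (hfin x).toFinset)
          (fun _ _ h => h.symm) hΔ hnbr v n 𝒮 h𝒮
    _ = 4 ^ (2 * n) := by norm_num

end Summit.CriticalPhenomena.SAWScalingLimit.Theorems.SAWMassiveIsingTilt

end
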